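import Literature.Geometry.Lorentzian.CarterConeRate
import HarnessLib

/-!
# Carter's coefficient on the thin cap of the threshold sliver: `φ − σ²` vanishes to first order at
# the horizon, and the cap edge is bracketed by two κ-free multiples of `σ²(r₊² + a²)²/((r₊ − r₋)Λ′)`
(namespace `Literature.Geometry.Lorentzian.Kerr`.)

Carter's radial equation `u″ + φu = 0`, `φ = ω² − V` (`V = Kerr.sepPotential M a ω m Λ`; DRSR
arXiv:1402.7034 §5.2.3) at a frequency in the THRESHOLD SLIVER `σ := ω − mω₊`, `0 < |σ| ≪ κ`, in a
Breitenlohner–Freedman stable sector with margin `(1 + θ₁)(2r₊ω)² ≤ Λ′` (`Λ′ = Λ − 2amω`,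
`0 < θ₁ ≤ 1`). With `S := (r₊² + a²)σ`, `K = S + ω(r − r₊)(r + r₊)`, `W₁ = (r² + a²)²V₁ ∈ [0, 3Δ]`,
`d = r₊ − r₋`:

* `sq_mul_coeff_sub_sq_eq` — the first-order identity
  `(r² + a²)²(ω² − V(r) − σ²) = (r − r₊)·[ω(r + r₊)(2S + ω(r − r₊)(r + r₊)) − σ²(r + r₊)(r² + r₊² + 2a²)
   − (r − r₋)Λ′] − W₁`;
* `abs_coeff_sub_sq_le` — on the first horizon width `r₊ < r ≤ r₊ + d`:
  `|ω² − V(r) − σ²| ≤ C_cap·Δ(r)/(r² + a²)²`, `C_cap = R₀/d + |Λ′| + 3`,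
  `R₀ = 3r₊|ω|(4Mr₊|σ| + 3r₊|ω|d) + 21σ²r₊³` — the interaction `∫|φ − σ²|/|σ|` over the cap is
  `O(|σ|/κ)` uniformly in `κ` (no `log κ⁻¹`);
* `sq_mul_negCoeff_ge_of_sliver` — for `r₊ < r ≤ r₊(1 + θ₁/8)`:
  `(r² + a²)²(V − ω²) ≥ Δ·θ₁Λ′/8 − (3/θ₁)(r₊² + a²)²σ²`; hence (`coeff_nonpos_of_sliver`) `ω² − V ≤ 0`
  once `24σ²(r₊² + a²)²/(dθ₁²Λ′) ≤ r − r₊`, and (`sq_mul_negCoeff_ge_of_sliver'`) the floor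
  `(r² + a²)²(V − ω²) ≥ Δθ₁Λ′/16` once `48σ²(r₊² + a²)²/(dθ₁²Λ′) ≤ r − r₊`;
* `coeff_pos_of_sliver` — for `r − r₊ ≤ d`, `r − r₊ < σ²(r₊² + a²)²/(8d(|Λ′| + 3))` and
  `6r₊|ω|(r − r₊) ≤ (r₊² + a²)|σ|`: `0 < ω² − V(r)` (the cap contains these radii).

Pure algebra from `sq_mul_coeff_eq`, `radialK_eq_horizon_add`, `sq_mul_negCoeff_ge_of_cone'`; the
inputs of the cap Grönwall bound and of the quasi-monotone propagation in the sliver case of the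
near-extremal Kerr programme (crux `KappaExplicitWaveDecay`, BF-stable large-`Λ` kernel bound).

## References
* M. Dafermos, I. Rodnianski, Y. Shlapentokh-Rothman, arXiv:1402.7034 = Ann. of Math. 183 (2016),
  §§5.2.3, 6.2 (key `DafermosRodnianskiShlapentokhrothman2014`). The algebra is folklore.
-/

noncomputable section

open Set

namespace Literature.Geometry.Lorentzian

namespace Kerr

section SliverCap

variable {M a ω Λ : ℝ} {m : ℤ}

/-- `0 ≤ r₋ = M − √(M² − a²)` for `|a| ≤ M`. [folklore] -/
theorem rMinus_nonneg_of_abs_le {M a : ℝ} (haM : |a| ≤ M) : 0 ≤ rMinus M a := by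
  have hM : 0 ≤ M := (abs_nonneg a).trans haM
  unfold rMinus
  have : Real.sqrt (M ^ 2 - a ^ 2) ≤ M := by
    rw [Real.sqrt_le_left hM]; nlinarith [sq_nonneg a]
  linarith

/-- **First-order identity at the horizon.** For `|a| < M` and `r > r₊`, with `σ = ω − mω₊`,
`S = (r₊² + a²)σ`:
`(r² + a²)²(ω² − V(r) − σ²) = (r − r₊)·[ω(r + r₊)(2S + ω(r − r₊)(r + r₊)) − σ²(r + r₊)(r² + r₊² + 2a²)
 − (r − r₋)(Λ − 2amω)] − (r² + a²)²V₁(r)`. [folklore] -/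
theorem sq_mul_coeff_sub_sq_eq (ha : |a| < M) {r : ℝ} (hr : rPlus M a < r) :
    (r ^ 2 + a ^ 2) ^ 2 * (ω ^ 2 - sepPotential M a ω m Λ r - (ω - m * horizonAngularVelocity M a) ^ 2) =
      (r - rPlus M a) *
          (ω * (r + rPlus M a) * (2 * ((rPlus M a ^ 2 + a ^ 2) * (ω - m * horizonAngularVelocity M a)) +
              ω * (r - rPlus M a) * (r + rPlus M a)) -
            (ω - m * horizonAngularVelocity M a) ^ 2 * (r + rPlus M a) * (r ^ 2 + rPlus M a ^ 2 + 2 * a ^ 2) -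
            (r - rMinus M a) * (Λ - 2 * a * m * ω)) -
        (r ^ 2 + a ^ 2) ^ 2 * sepPotential₁ M a r := by
  have hM : 0 < M := lt_of_le_of_lt (abs_nonneg a) ha
  have hrp : 0 < rPlus M a := rPlus_pos hM a
  have hr0 : 0 < r := hrp.trans hr
  have hA : r ^ 2 + a ^ 2 ≠ 0 := by positivity
  have h := sq_mul_coeff_eq M a ω m Λ hA
  have hK := radialK_eq_horizon_add hM ha.le ω m r
  have hΔ : delta M a r = (r - rPlus M a) * (r - rMinus M a) := delta_eq_mul ha.le r
  have e : (r ^ 2 + a ^ 2) ^ 2 * (ω ^ 2 - sepPotential M a ω m Λ r -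
      (ω - m * horizonAngularVelocity M a) ^ 2) =
      (r ^ 2 + a ^ 2) ^ 2 * (ω ^ 2 - sepPotential M a ω m Λ r) -
        (r ^ 2 + a ^ 2) ^ 2 * (ω - m * horizonAngularVelocity M a) ^ 2 := by ring
  rw [e, h, hK, hΔ]
  ring

/-- **The cap coefficient bound.** For `|a| < M`, `r₊ < r ≤ r₊ + (r₊ − r₋)`, with `σ = ω − mω₊`,
`d = r₊ − r₋`: `|ω² − V(r) − σ²| ≤ (R₀/d + |Λ − 2amω| + 3)·Δ(r)/(r² + a²)²`,
`R₀ = 3r₊|ω|(4Mr₊|σ| + 3r₊|ω|d) + 21σ²r₊³`. [folklore] -/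
theorem abs_coeff_sub_sq_le (ha : |a| < M) {r : ℝ} (hr : rPlus M a < r)
    (hrd : r - rPlus M a ≤ rPlus M a - rMinus M a) :
    |ω ^ 2 - sepPotential M a ω m Λ r - (ω - m * horizonAngularVelocity M a) ^ 2| ≤
      ((3 * rPlus M a * |ω| * (4 * M * rPlus M a * |ω - m * horizonAngularVelocity M a| +
          3 * rPlus M a * |ω| * (rPlus M a - rMinus M a)) +
          21 * (ω - m * horizonAngularVelocity M a) ^ 2 * rPlus M a ^ 3) / (rPlus M a - rMinus M a) +
        |Λ - 2 * a * m * ω| + 3) * delta M a r / (r ^ 2 + a ^ 2) ^ 2 := by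
  have hsub : IsSubextremal M a := ha
  have hM : 0 < M := hsub.pos
  have hrp : 0 < rPlus M a := rPlus_pos hM a
  have hr0 : 0 < r := hrp.trans hr
  have hA : 0 < (r ^ 2 + a ^ 2) ^ 2 := by positivity
  have hd : 0 < rPlus M a - rMinus M a := sub_pos.2 hsub.rMinus_lt_rPlus
  have hrm0 : 0 ≤ rMinus M a := rMinus_nonneg_of_abs_le ha.le
  -- the identity and `W₁ ∈ [0, 3Δ]` (instantiated before the abbreviations)
  have hid := sq_mul_coeff_sub_sq_eq (ω := ω) (Λ := Λ) (m := m) ha hr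
  have hW0 : 0 ≤ (r ^ 2 + a ^ 2) ^ 2 * sepPotential₁ M a r :=
    mul_nonneg (sq_nonneg _) (sepPotential₁_nonneg ha.le hr.le)
  have hW3 := sq_mul_sepPotential₁_le hM ha.le hr.le
  have hΔr : delta M a r = (r - rPlus M a) * (r - rMinus M a) := delta_eq_mul ha.le r
  have hAp : rPlus M a ^ 2 + a ^ 2 = 2 * M * rPlus M a := rPlus_sq_add_sq ha.le
  set σ := ω - m * horizonAngularVelocity M a with hσ
  set d := rPlus M a - rMinus M a with hddef
  set Λ' := Λ - 2 * a * m * ω with hΛ'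
  set X := r - rPlus M a with hX
  set Y := r - rMinus M a with hY
  have hX0 : 0 < X := sub_pos.2 hr
  have hYd : d ≤ Y := by rw [hY, hddef]; linarith only [hrm0, hr, hrp]
  have hY0 : 0 < Y := hd.trans_le hYd
  have hΔ : delta M a r = X * Y := hΔr
  -- size of the geometric factors on the first horizon width
  have hr2 : r ≤ 2 * rPlus M a := by linarith only [hrd, hrm0, hX, hddef]
  have hsum : r + rPlus M a ≤ 3 * rPlus M a := by linarith only [hr2]
  have hsum0 : 0 < r + rPlus M a := by linarith only [hr, hrp]
  have ha2 : a ^ 2 ≤ rPlus M a ^ 2 := by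
    have h1 : |a| ≤ rPlus M a := ha.le.trans (M_le_rPlus M a)
    nlinarith [sq_abs a, abs_nonneg a]
  have hcub : r ^ 2 + rPlus M a ^ 2 + 2 * a ^ 2 ≤ 7 * rPlus M a ^ 2 := by
    nlinarith only [hr2, ha2, hr0, hrp]
  -- the three terms of the bracket
  set R₀ := 3 * rPlus M a * |ω| * (4 * M * rPlus M a * |σ| + 3 * rPlus M a * |ω| * d) +
    21 * σ ^ 2 * rPlus M a ^ 3 with hR₀
  have hR₀0 : 0 ≤ R₀ := by rw [hR₀]; positivity
  clear_value σ d Λ' X Y R₀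
  have hp : |ω * (r + rPlus M a) * (2 * ((rPlus M a ^ 2 + a ^ 2) * σ) + ω * X * (r + rPlus M a))| ≤
      3 * rPlus M a * |ω| * (4 * M * rPlus M a * |σ| + 3 * rPlus M a * |ω| * d) := by
    rw [abs_mul, abs_mul, abs_of_pos hsum0, hAp]
    have h1 : |2 * (2 * M * rPlus M a * σ) + ω * X * (r + rPlus M a)| ≤
        4 * M * rPlus M a * |σ| + 3 * rPlus M a * |ω| * d := by
      refine (abs_add_le _ _).trans (add_le_add ?_ ?_)
      · rw [abs_mul, abs_mul, abs_of_pos (by norm_num : (0:ℝ) < 2),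
          abs_of_pos (by positivity : 0 < 2 * M * rPlus M a)]; linarith only
      · rw [abs_mul, abs_mul, abs_of_pos hX0, abs_of_pos hsum0]
        have : |ω| * X * (r + rPlus M a) ≤ |ω| * d * (3 * rPlus M a) :=
          mul_le_mul (mul_le_mul_of_nonneg_left hrd (abs_nonneg _)) hsum hsum0.le (by positivity)
        linarith only [this]
    calc |ω| * (r + rPlus M a) * |2 * (2 * M * rPlus M a * σ) + ω * X * (r + rPlus M a)|
        ≤ |ω| * (3 * rPlus M a) * (4 * M * rPlus M a * |σ| + 3 * rPlus M a * |ω| * d) :=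
          mul_le_mul (mul_le_mul_of_nonneg_left hsum (abs_nonneg _)) h1 (abs_nonneg _) (by positivity)
      _ = 3 * rPlus M a * |ω| * (4 * M * rPlus M a * |σ| + 3 * rPlus M a * |ω| * d) := by ring
  have hq : |σ ^ 2 * (r + rPlus M a) * (r ^ 2 + rPlus M a ^ 2 + 2 * a ^ 2)| ≤ 21 * σ ^ 2 * rPlus M a ^ 3 := by
    rw [abs_of_nonneg (by positivity)]
    calc σ ^ 2 * (r + rPlus M a) * (r ^ 2 + rPlus M a ^ 2 + 2 * a ^ 2)
        ≤ σ ^ 2 * (3 * rPlus M a) * (7 * rPlus M a ^ 2) :=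
          mul_le_mul (mul_le_mul_of_nonneg_left hsum (sq_nonneg _)) hcub (by positivity) (by positivity)
      _ = 21 * σ ^ 2 * rPlus M a ^ 3 := by ring
  have ht : |Y * Λ'| = Y * |Λ'| := by rw [abs_mul, abs_of_pos hY0]
  -- the bracket is at most `R₀ + Y|Λ′| ≤ Y (R₀/d + |Λ′|)`
  have hBr : |ω * (r + rPlus M a) * (2 * ((rPlus M a ^ 2 + a ^ 2) * σ) + ω * X * (r + rPlus M a)) -
      σ ^ 2 * (r + rPlus M a) * (r ^ 2 + rPlus M a ^ 2 + 2 * a ^ 2) - Y * Λ'| ≤ Y * (R₀ / d + |Λ'|) := by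
    have h1 := abs_sub_le (ω * (r + rPlus M a) * (2 * ((rPlus M a ^ 2 + a ^ 2) * σ) +
      ω * X * (r + rPlus M a)) - σ ^ 2 * (r + rPlus M a) * (r ^ 2 + rPlus M a ^ 2 + 2 * a ^ 2)) 0 (Y * Λ')
    have h2 := abs_sub (ω * (r + rPlus M a) * (2 * ((rPlus M a ^ 2 + a ^ 2) * σ) +
      ω * X * (r + rPlus M a))) (σ ^ 2 * (r + rPlus M a) * (r ^ 2 + rPlus M a ^ 2 + 2 * a ^ 2))
    rw [sub_zero, zero_sub, abs_neg] at h1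
    have hR₀Y : R₀ ≤ Y * (R₀ / d) := by
      rw [mul_div_assoc', le_div_iff₀ hd]; nlinarith only [hR₀0, hYd]
    have : Y * (R₀ / d + |Λ'|) = Y * (R₀ / d) + Y * |Λ'| := by ring
    rw [this]
    linarith only [h1, h2, hp, hq, ht.le, ht.ge, hR₀Y, hR₀]
  -- assemble
  rw [le_div_iff₀ hA]
  have habs : |(r ^ 2 + a ^ 2) ^ 2 * (ω ^ 2 - sepPotential M a ω m Λ r - σ ^ 2)| ≤
      (R₀ / d + |Λ'| + 3) * delta M a r := by
    rw [hid]
    refine (abs_sub _ _).trans ?_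
    rw [abs_mul, abs_of_pos hX0, abs_of_nonneg hW0, hΔ]
    have h1 : X * |ω * (r + rPlus M a) * (2 * ((rPlus M a ^ 2 + a ^ 2) * σ) + ω * X * (r + rPlus M a)) -
        σ ^ 2 * (r + rPlus M a) * (r ^ 2 + rPlus M a ^ 2 + 2 * a ^ 2) - Y * Λ'| ≤ X * (Y * (R₀ / d + |Λ'|)) :=
      mul_le_mul_of_nonneg_left hBr hX0.le
    rw [hΔ] at hW3
    have e1 : X * (Y * (R₀ / d + |Λ'|)) = (R₀ / d + |Λ'|) * (X * Y) := by ring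
    have e2 : (R₀ / d + |Λ'| + 3) * (X * Y) = (R₀ / d + |Λ'|) * (X * Y) + 3 * (X * Y) := by ring
    linarith only [h1, hW3, e1, e2]
  calc |ω ^ 2 - sepPotential M a ω m Λ r - σ ^ 2| * (r ^ 2 + a ^ 2) ^ 2
      = |(r ^ 2 + a ^ 2) ^ 2 * (ω ^ 2 - sepPotential M a ω m Λ r - σ ^ 2)| := by
        rw [abs_mul, abs_of_pos hA, mul_comm]
    _ ≤ (R₀ / d + |Λ'| + 3) * delta M a r := habs

/-! ### The barrier starts within `x*` horizon widths and the cap contains `x_low` horizon widths -/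

/-- **Lower profile bound on the collar of the sliver.** For `|a| < M`, `0 < θ₁ ≤ 1`, the margin
`(1 + θ₁)(2r₊ω)² ≤ Λ′` and `r₊ < r ≤ r₊(1 + θ₁/8)`:
`Δ·θ₁Λ′/8 − (3/θ₁)((r₊² + a²)σ)² ≤ (r² + a²)²(V(r) − ω²)` (`sq_mul_negCoeff_ge_of_cone'` with
`ε = θ₁/2`, and `(1 + θ₁/2)(2 + θ₁/8)² ≤ 4(1 + θ₁) − θ₁/2`… precisely `≤ (4(1 + θ₁))(1 − θ₁/8)`).
[folklore] -/
theorem sq_mul_negCoeff_ge_of_sliver (ha : |a| < M) {θ₁ : ℝ} (hθ₁ : 0 < θ₁) (hθ₁1 : θ₁ ≤ 1)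
    (hBF : (1 + θ₁) * (2 * rPlus M a * ω) ^ 2 ≤ Λ - 2 * a * m * ω) {r : ℝ} (hr : rPlus M a < r)
    (hrθ : r ≤ rPlus M a * (1 + θ₁ / 8)) :
    delta M a r * (θ₁ * (Λ - 2 * a * m * ω) / 8) -
        3 / θ₁ * ((rPlus M a ^ 2 + a ^ 2) * (ω - m * horizonAngularVelocity M a)) ^ 2 ≤
      (r ^ 2 + a ^ 2) ^ 2 * (sepPotential M a ω m Λ r - ω ^ 2) := by
  have hM : 0 < M := lt_of_le_of_lt (abs_nonneg a) ha
  have hrp : 0 < rPlus M a := rPlus_pos hM a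
  have hΔ : 0 ≤ delta M a r := delta_nonneg ha.le hr.le
  set Λ' := Λ - 2 * a * m * ω with hΛ'
  have h := sq_mul_negCoeff_ge_of_cone' (ω := ω) (Λ := Λ) (m := m) ha (half_pos hθ₁) hr
  -- `(1 + θ₁/2) ω²(r + r₊)² ≤ (1 − θ₁/8)Λ′`
  have hω2 : 0 ≤ ω ^ 2 := sq_nonneg ω
  have h1 : (1 + θ₁ / 2) * (ω ^ 2 * (r + rPlus M a) ^ 2) ≤ (1 - θ₁ / 8) * Λ' := by
    have h2 : (r + rPlus M a) ^ 2 ≤ (rPlus M a * (2 + θ₁ / 8)) ^ 2 :=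
      pow_le_pow_left₀ (by linarith) (by linarith) 2
    have h3 : (1 + θ₁ / 2) * (2 + θ₁ / 8) ^ 2 ≤ 4 * (1 + θ₁) * (1 - θ₁ / 8) := by
      have t1 : θ₁ ^ 2 ≤ θ₁ := by nlinarith only [hθ₁, hθ₁1]
      have t2 : θ₁ ^ 3 ≤ θ₁ := by nlinarith only [hθ₁, hθ₁1, t1]
      nlinarith only [t1, t2, hθ₁]
    have h4 : 4 * rPlus M a ^ 2 * ω ^ 2 ≤ Λ' / (1 + θ₁) := by
      rw [le_div_iff₀ (by linarith)]; linarith [hBF]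
    calc (1 + θ₁ / 2) * (ω ^ 2 * (r + rPlus M a) ^ 2)
        ≤ (1 + θ₁ / 2) * (ω ^ 2 * (rPlus M a * (2 + θ₁ / 8)) ^ 2) := by gcongr
      _ = (1 + θ₁ / 2) * (2 + θ₁ / 8) ^ 2 * (rPlus M a ^ 2 * ω ^ 2) := by ring
      _ ≤ 4 * (1 + θ₁) * (1 - θ₁ / 8) * (rPlus M a ^ 2 * ω ^ 2) :=
          mul_le_mul_of_nonneg_right h3 (by positivity)
      _ = (1 + θ₁) * (1 - θ₁ / 8) * (4 * rPlus M a ^ 2 * ω ^ 2) := by ring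
      _ ≤ (1 + θ₁) * (1 - θ₁ / 8) * (Λ' / (1 + θ₁)) :=
          mul_le_mul_of_nonneg_left h4 (by nlinarith)
      _ = (1 - θ₁ / 8) * Λ' := by field_simp
  have h5 : delta M a r * (θ₁ * Λ' / 8) ≤ delta M a r * (Λ' - (1 + θ₁ / 2) * (ω ^ 2 * (r + rPlus M a) ^ 2)) :=
    mul_le_mul_of_nonneg_left (by linarith) hΔ
  have h6 : (1 + (θ₁ / 2)⁻¹) * ((rPlus M a ^ 2 + a ^ 2) * (ω - m * horizonAngularVelocity M a)) ^ 2 ≤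
      3 / θ₁ * ((rPlus M a ^ 2 + a ^ 2) * (ω - m * horizonAngularVelocity M a)) ^ 2 := by
    refine mul_le_mul_of_nonneg_right ?_ (sq_nonneg _)
    rw [inv_div]
    have : 2 / θ₁ + 1 ≤ 3 / θ₁ := by
      rw [div_add_one hθ₁.ne', div_le_div_iff_of_pos_right hθ₁]; linarith
    linarith
  linarith [h, h5, h6]

/-- **The barrier starts within `x*` horizon widths**: under the hypotheses of
`sq_mul_negCoeff_ge_of_sliver`, if moreover `24((r₊² + a²)σ)²/((r₊ − r₋)θ₁²Λ′) ≤ r − r₊` then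
`ω² − V(r) ≤ 0`. [folklore] -/
theorem coeff_nonpos_of_sliver (ha : |a| < M) {θ₁ : ℝ} (hθ₁ : 0 < θ₁) (hθ₁1 : θ₁ ≤ 1)
    (hBF : (1 + θ₁) * (2 * rPlus M a * ω) ^ 2 ≤ Λ - 2 * a * m * ω) (hΛ' : 0 < Λ - 2 * a * m * ω)
    {r : ℝ} (hr : rPlus M a < r) (hrθ : r ≤ rPlus M a * (1 + θ₁ / 8))
    (hx : 24 * ((rPlus M a ^ 2 + a ^ 2) * (ω - m * horizonAngularVelocity M a)) ^ 2 /
      ((rPlus M a - rMinus M a) * θ₁ ^ 2 * (Λ - 2 * a * m * ω)) ≤ r - rPlus M a) :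
    ω ^ 2 - sepPotential M a ω m Λ r ≤ 0 := by
  have hsub : IsSubextremal M a := ha
  have hM : 0 < M := hsub.pos
  have hrp : 0 < rPlus M a := rPlus_pos hM a
  have hr0 : 0 < r := hrp.trans hr
  have hd : 0 < rPlus M a - rMinus M a := sub_pos.2 hsub.rMinus_lt_rPlus
  have hA : 0 < (r ^ 2 + a ^ 2) ^ 2 := by positivity
  set S := (rPlus M a ^ 2 + a ^ 2) * (ω - m * horizonAngularVelocity M a) with hS
  set Λ' := Λ - 2 * a * m * ω with hΛ'def
  have h := sq_mul_negCoeff_ge_of_sliver (ω := ω) (Λ := Λ) (m := m) ha hθ₁ hθ₁1 hBF hr hrθ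
  -- `Δ ≥ (r − r₊)d ≥ 24 S²/(θ₁²Λ′)`, so `Δθ₁Λ′/8 ≥ 3S²/θ₁`
  have hΔ : (r - rPlus M a) * (rPlus M a - rMinus M a) ≤ delta M a r := by
    rw [delta_eq_mul ha.le]
    exact mul_le_mul_of_nonneg_left (by linarith) (by linarith)
  have h1 : 24 * S ^ 2 / (θ₁ ^ 2 * Λ') ≤ delta M a r := by
    have : 24 * S ^ 2 / ((rPlus M a - rMinus M a) * θ₁ ^ 2 * Λ') * (rPlus M a - rMinus M a) ≤
        (r - rPlus M a) * (rPlus M a - rMinus M a) := mul_le_mul_of_nonneg_right hx hd.le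
    have e : 24 * S ^ 2 / ((rPlus M a - rMinus M a) * θ₁ ^ 2 * Λ') * (rPlus M a - rMinus M a) =
        24 * S ^ 2 / (θ₁ ^ 2 * Λ') := by field_simp
    rw [e] at this
    exact this.trans hΔ
  have h2 : 3 / θ₁ * S ^ 2 ≤ delta M a r * (θ₁ * Λ' / 8) := by
    have := mul_le_mul_of_nonneg_right h1 (show 0 ≤ θ₁ * Λ' / 8 by positivity)
    have e : 24 * S ^ 2 / (θ₁ ^ 2 * Λ') * (θ₁ * Λ' / 8) = 3 / θ₁ * S ^ 2 := by field_simp; ring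
    rw [e] at this; exact this
  have h3 : 0 ≤ (r ^ 2 + a ^ 2) ^ 2 * (sepPotential M a ω m Λ r - ω ^ 2) := by linarith
  have : 0 ≤ sepPotential M a ω m Λ r - ω ^ 2 := by
    by_contra hcon; push Not at hcon
    have : (r ^ 2 + a ^ 2) ^ 2 * (sepPotential M a ω m Λ r - ω ^ 2) < 0 := mul_neg_of_pos_of_neg hA hcon
    linarith
  linarith

/-- **The quantitative floor from `2x*` on**: under the hypotheses of `sq_mul_negCoeff_ge_of_sliver`,
if `48((r₊² + a²)σ)²/((r₊ − r₋)θ₁²Λ′) ≤ r − r₊` then `Δ(r)·θ₁Λ′/16 ≤ (r² + a²)²(V(r) − ω²)`.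
[folklore] -/
theorem sq_mul_negCoeff_ge_of_sliver' (ha : |a| < M) {θ₁ : ℝ} (hθ₁ : 0 < θ₁) (hθ₁1 : θ₁ ≤ 1)
    (hBF : (1 + θ₁) * (2 * rPlus M a * ω) ^ 2 ≤ Λ - 2 * a * m * ω) (hΛ' : 0 < Λ - 2 * a * m * ω)
    {r : ℝ} (hr : rPlus M a < r) (hrθ : r ≤ rPlus M a * (1 + θ₁ / 8))
    (hx : 48 * ((rPlus M a ^ 2 + a ^ 2) * (ω - m * horizonAngularVelocity M a)) ^ 2 /
      ((rPlus M a - rMinus M a) * θ₁ ^ 2 * (Λ - 2 * a * m * ω)) ≤ r - rPlus M a) :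
    delta M a r * (θ₁ * (Λ - 2 * a * m * ω) / 16) ≤
      (r ^ 2 + a ^ 2) ^ 2 * (sepPotential M a ω m Λ r - ω ^ 2) := by
  have hsub : IsSubextremal M a := ha
  have hd : 0 < rPlus M a - rMinus M a := sub_pos.2 hsub.rMinus_lt_rPlus
  set S := (rPlus M a ^ 2 + a ^ 2) * (ω - m * horizonAngularVelocity M a) with hS
  set Λ' := Λ - 2 * a * m * ω with hΛ'def
  have h := sq_mul_negCoeff_ge_of_sliver (ω := ω) (Λ := Λ) (m := m) ha hθ₁ hθ₁1 hBF hr hrθ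
  have hΔ : (r - rPlus M a) * (rPlus M a - rMinus M a) ≤ delta M a r := by
    rw [delta_eq_mul ha.le]
    exact mul_le_mul_of_nonneg_left (by linarith) (by linarith)
  have h1 : 48 * S ^ 2 / (θ₁ ^ 2 * Λ') ≤ delta M a r := by
    have : 48 * S ^ 2 / ((rPlus M a - rMinus M a) * θ₁ ^ 2 * Λ') * (rPlus M a - rMinus M a) ≤
        (r - rPlus M a) * (rPlus M a - rMinus M a) := mul_le_mul_of_nonneg_right hx hd.le
    have e : 48 * S ^ 2 / ((rPlus M a - rMinus M a) * θ₁ ^ 2 * Λ') * (rPlus M a - rMinus M a) =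
        48 * S ^ 2 / (θ₁ ^ 2 * Λ') := by field_simp
    rw [e] at this
    exact this.trans hΔ
  have h2 : 3 / θ₁ * S ^ 2 ≤ delta M a r * (θ₁ * Λ' / 16) := by
    have := mul_le_mul_of_nonneg_right h1 (show 0 ≤ θ₁ * Λ' / 16 by positivity)
    have e : 48 * S ^ 2 / (θ₁ ^ 2 * Λ') * (θ₁ * Λ' / 16) = 3 / θ₁ * S ^ 2 := by field_simp; ring
    rw [e] at this; exact this
  have e : delta M a r * (θ₁ * Λ' / 8) = delta M a r * (θ₁ * Λ' / 16) + delta M a r * (θ₁ * Λ' / 16) := by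
    ring
  linarith [h, h2, e]

/-- **The cap contains `x_low` horizon widths.** For `|a| < M`, `r₊ < r` with `r − r₊ ≤ r₊ − r₋`,
`6r₊|ω|(r − r₊) ≤ (r₊² + a²)|σ|` and `r − r₊ < ((r₊² + a²)σ)²/(8(r₊ − r₋)(|Λ′| + 3))`: `0 < ω² − V(r)`
(`K² ≥ S²/4` since `|ω(r − r₊)(r + r₊)| ≤ |S|/2`, while `Δ(|Λ′| + 3) ≤ 2d(r − r₊)(|Λ′| + 3) < S²/4`).
[folklore] -/
theorem coeff_pos_of_sliver (ha : |a| < M) {r : ℝ} (hr : rPlus M a < r)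
    (hrd : r - rPlus M a ≤ rPlus M a - rMinus M a)
    (hK : 6 * rPlus M a * |ω| * (r - rPlus M a) ≤
      (rPlus M a ^ 2 + a ^ 2) * |ω - m * horizonAngularVelocity M a|)
    (hx : r - rPlus M a < ((rPlus M a ^ 2 + a ^ 2) * (ω - m * horizonAngularVelocity M a)) ^ 2 /
      (8 * (rPlus M a - rMinus M a) * (|Λ - 2 * a * m * ω| + 3))) :
    0 < ω ^ 2 - sepPotential M a ω m Λ r := by
  have hsub : IsSubextremal M a := ha
  have hM : 0 < M := hsub.pos
  have hrp : 0 < rPlus M a := rPlus_pos hM a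
  have hr0 : 0 < r := hrp.trans hr
  have hA : 0 < (r ^ 2 + a ^ 2) ^ 2 := by positivity
  have hAne : r ^ 2 + a ^ 2 ≠ 0 := by positivity
  have hd : 0 < rPlus M a - rMinus M a := sub_pos.2 hsub.rMinus_lt_rPlus
  set σ := ω - m * horizonAngularVelocity M a with hσ
  set S := (rPlus M a ^ 2 + a ^ 2) * σ with hS
  set Λ' := Λ - 2 * a * m * ω with hΛ'def
  set X := r - rPlus M a with hX
  have hX0 : 0 < X := sub_pos.2 hr
  -- the identity `(r² + a²)²(ω² − V) = K² − ΔΛ′ − W₁`, `K = S + ωX(r + r₊)`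
  have hid := sq_mul_coeff_eq M a ω m Λ hAne
  have hKeq := radialK_eq_horizon_add hM ha.le ω m r
  have hW3 := sq_mul_sepPotential₁_le hM ha.le hr.le
  have hΔeq : delta M a r = X * (r - rMinus M a) := by rw [hX]; exact delta_eq_mul ha.le r
  have hΔ2 : delta M a r ≤ 2 * (rPlus M a - rMinus M a) * X := by
    rw [hΔeq]
    have : r - rMinus M a ≤ 2 * (rPlus M a - rMinus M a) := by linarith
    nlinarith [this, hX0]
  have hΔ0 : 0 ≤ delta M a r := delta_nonneg ha.le hr.le
  -- `|ωX(r + r₊)| ≤ |S|/2`, hence `K² ≥ S²/4`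
  have hsum0 : 0 < r + rPlus M a := by linarith
  have hsum : r + rPlus M a ≤ 3 * rPlus M a := by
    have := hsub.rMinus_lt_rPlus; have := rMinus_nonneg_of_abs_le ha.le; linarith
  have hB : |ω * X * (r + rPlus M a)| ≤ |S| / 2 := by
    rw [abs_mul, abs_mul, abs_of_pos hX0, abs_of_pos hsum0, hS, abs_mul,
      abs_of_pos (by positivity : 0 < rPlus M a ^ 2 + a ^ 2)]
    calc |ω| * X * (r + rPlus M a) ≤ |ω| * X * (3 * rPlus M a) :=
          mul_le_mul_of_nonneg_left hsum (by positivity)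
      _ = (6 * rPlus M a * |ω| * X) / 2 := by ring
      _ ≤ (rPlus M a ^ 2 + a ^ 2) * |σ| / 2 := by linarith
  have hK2 : S ^ 2 / 4 ≤ radialK a ω m r ^ 2 := by
    rw [hKeq, ← hσ, ← hS]
    have h1 : |S| / 2 ≤ |S + ω * X * (r + rPlus M a)| := by
      have := abs_sub_abs_le_abs_sub S (-(ω * X * (r + rPlus M a)))
      rw [abs_neg, sub_neg_eq_add] at this
      linarith
    have h2 : (|S| / 2) ^ 2 ≤ |S + ω * X * (r + rPlus M a)| ^ 2 := pow_le_pow_left₀ (by positivity) h1 2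
    rw [sq_abs, div_pow, sq_abs] at h2
    have e : ω * (r - rPlus M a) * (r + rPlus M a) = ω * X * (r + rPlus M a) := by rw [hX]
    rw [e]; linarith
  -- `ΔΛ′ + W₁ ≤ Δ(|Λ′| + 3) ≤ 2dX(|Λ′| + 3) < S²/4`
  have hrest : delta M a r * Λ' + (r ^ 2 + a ^ 2) ^ 2 * sepPotential₁ M a r < S ^ 2 / 4 := by
    have h1 : delta M a r * Λ' ≤ delta M a r * |Λ'| := mul_le_mul_of_nonneg_left (le_abs_self _) hΔ0
    have h2 : delta M a r * (|Λ'| + 3) ≤ 2 * (rPlus M a - rMinus M a) * X * (|Λ'| + 3) :=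
      mul_le_mul_of_nonneg_right hΔ2 (by positivity)
    have h3 : 2 * (rPlus M a - rMinus M a) * X * (|Λ'| + 3) < S ^ 2 / 4 := by
      have := (lt_div_iff₀ (by positivity)).1 hx
      have e : X * (8 * (rPlus M a - rMinus M a) * (|Λ'| + 3)) =
          4 * (2 * (rPlus M a - rMinus M a) * X * (|Λ'| + 3)) := by ring
      linarith only [this, e]
    have e2 : delta M a r * (|Λ'| + 3) = delta M a r * |Λ'| + 3 * delta M a r := by ring
    linarith only [h1, h2, h3, hW3, e2]
  have hpos : 0 < (r ^ 2 + a ^ 2) ^ 2 * (ω ^ 2 - sepPotential M a ω m Λ r) := by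
    rw [hid]; linarith
  exact (mul_pos_iff_of_pos_left hA).1 hpos

end SliverCap

end Kerr

end Literature.Geometry.Lorentzian

end
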